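import Summits.QuantumFields.QCD.Theses.PauliWegnerSea
import Literature.MathematicalPhysics.QuantumFieldTheory.QCDCurrentSector
import Literature.MathematicalPhysics.QuantumFieldTheory.QCDTimeReflection
import Summits.QuantumFields.QCD.Theorems.SpectralDefectExtinctionWindowExtinctionChessboardTransferFragments
-- (add further imports your proof needs here: Mathlib.*, Literature.*, Summits.QuantumFields.QCD.Theorems.*)
import Literature.MathematicalPhysics.QuantumFieldTheory.FermiFlavourPhase
import Summits.QuantumFields.QCD.Theorems.PauliWegnerSeaPhaseQuenchedFlavourDecayPionSecondMomentOfCrux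
import Summits.QuantumFields.QCD.Theorems.PauliWegnerSeaChiralOneScaleTrajectoryStubPinOfLatticeLightnessAux

/-!
# The lift: lattice lightness pins chirality (crux `PauliWegnerSea.ChiralOneScaleTrajectory`, stmt-QuantumFields-17512, line `log-convex-continuum-lift`,
registered stub `stub_pinOfLatticeLightness` of skeleton v2 `Cruxes/ChiralOneScaleTrajectory/Lines/log_convex_continuum_lift.lean`)

**What is proved.**  `stub_pinOfLatticeLightness`: for every `N_f`, the RP–Hankel form of transfer
positivity `TP⟪Nf⟫` and the chord inequality `CHORD` imply, for every mass-independent regularisation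
`reg` with `β_k ≥ 0` eventually, admissible bare masses (clause (i)), superlogarithmic physical volume
`LOGROOM⟪reg⟫`, twist insensitivity `TWIST⟪Nf, reg⟫` and lattice lightness `LIGHT⟪Nf, reg⟫`, the chiral
pin `reg.IsChiralAtZero`.  Pure lattice bookkeeping + real arithmetic, no physics:

* fix `ε > 0`; `LIGHT ε` supplies positive masses `m`, a charged flavour pair `f ≠ g`, `R, p, C > 0` and,
  FREQUENTLY in `k`, a light profile `(T, h)` with even times `2n₁ < 2n₂`, a polynomial floor and the
  lightness bound at `S = L_k`; `m` is the witness of `IsChiralAtZero`;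
* if `reg.scheme m 0 0` had the uniform lattice gap `ε`, apply it to the flavour-charged pseudoscalar pair
  `A = ψ̄_g γ₅ ψ_f`, `B = ψ̄_f γ₅ ψ_g` (`pseudoscalarDensityObs Nf (Matrix.single · · 1)`): flavour charge
  removes the disconnected part (`IsFlavourCharged.qcdLatticeConnectedCorr_eq`) and
  `pseudoscalarDensityObs_single_onTorus` identifies the correlator at separation `n` with `N_P(n e₀)/Z_P`;
* intersect the frequent set with the eventual ones (gap bound, `β_k ≥ 0`, bare masses `> −1`, `TWIST`
  with constant `K + 2`, `K := 2(p+1)/ε`, `a_k ≤ 1/2`, `C' a_k < C/3`, `a_k < e^{−2R/K}`,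
  `max(2R, K+2) ≤ a_k L_k/(1+|log a_k|)` from `LOGROOM`) and pick ONE index `k`
  (`Frequently.and_eventually`, `Frequently.exists`);
* at that `k` everything is the abstract real/complex arithmetic of
  `PauliWegnerSeaChiralOneScaleTrajectoryStubPinOfLatticeLightnessAux` (`stub_pinOfLatticeLightness_core`): `E_j := ‖𝒟_h(2j)‖`
  is locally log-convex by (G1)–(G2), the chord at the log-scale time `t = ⌈K|log a|/(2a)⌉`, lightness and
  the floor give `E_t ≥ C a^p (Σ|h|)² ‖Z_AP‖ e^{−εat}`, (G3) gives `‖N_AP(2t e₀)‖ ≥ E_t/(Σ|h|)²`, the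
  twist gives `‖N_P/Z_P‖ ≥ (C/3) a^p e^{−εat}`, and the gap `≤ C' e^{−2εat}` with `e^{εat} ≥ a^{−(p+1)}`
  forces `(C/3) a⁻¹ ≤ C'`, contradicting the choice of `k`.

Sources: folklore bookkeeping over the tree's objects (I. Montvay, G. Münster, *Quantum Fields on a
Lattice* (CUP 1994), §5.1; K. Osterwalder, E. Seiler, Ann. Phys. 110 (1978) 440, §2, for the lattice QCD
functional and the flavoured pseudoscalar pair).
-/

noncomputable section

-- keep this namespace prefix; the LAST component is yours (one sub-namespace per stub file)
namespace Summit.QuantumFields.QCD.Cruxes.ChiralOneScaleTrajectory.LogConvexLift.Lift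

open scoped BigOperators Topology ComplexOrder
open MeasureTheory Filter
open Literature.MathematicalPhysics.QuantumFieldTheory Literature.MathematicalPhysics.QuantumLattice
  Literature.Probability.LatticeModels

/-! ### NOTATION PRELUDE (paste verbatim into every stub work file; expands to tree declarations only)

* `nAP⟪β, S, mq, f, g, v⟫` — UN-normalised antiperiodic flavoured pion numerator on the torus of side `2S+1`:
  `∫dμ_W(β) ∫dψ̄dψ (ψ̄_g γ₅ ψ_f)(0) · (ψ̄_f γ₅ ψ_g)(v) · e^{−ψ̄ D_AP(U) ψ}` (`v : Site 4`, read mod `2S+1`);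
* `nP⟪…⟫` — the same with the Statement's time-PERIODIC `fermiBoltzmann`;
* `zAP⟪β, S, mq⟫`, `zP⟪β, S, mq⟫` — the two partition functions;
* `dAP⟪β, S, mq, f, g, T, h, n⟫` — the source-and-sink smeared trace `𝒟_h(n) = Σ_{z,z' ∈ T} h z h z' N_AP(n e₀ + z' − z)`
  for a real profile `h` on the finite set `T` of (spatial) sites;
* `APTI⟪Nf⟫`, `TP⟪Nf⟫`, `CHORD`, `LOGROOM⟪reg⟫`, `TWIST⟪Nf, reg⟫`, `LIGHT⟪Nf, reg⟫` — the Props of the stubs. -/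

local notation "SU3" => Matrix.specialUnitaryGroup (Fin 3) ℂ

local notation "nAP⟪" β ", " S ", " mq ", " f ", " g ", " v "⟫" =>
  (∫ U : GaugeConfig 4 (2 * S + 1) (Matrix.specialUnitaryGroup (Fin 3) ℂ),
      fermiIntegral (torusBilinear g f (Torus.proj (2 * S + 1) 0) (Torus.proj (2 * S + 1) 0) gammaFive 1 *
          torusBilinear f g (Torus.proj (2 * S + 1) v) (Torus.proj (2 * S + 1) v) gammaFive 1 *
        fermiBoltzmannAP U mq)
    ∂(wilsonMeasure (fundamentalRep (Fin 3)) β))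

local notation "nP⟪" β ", " S ", " mq ", " f ", " g ", " v "⟫" =>
  (∫ U : GaugeConfig 4 (2 * S + 1) (Matrix.specialUnitaryGroup (Fin 3) ℂ),
      fermiIntegral (torusBilinear g f (Torus.proj (2 * S + 1) 0) (Torus.proj (2 * S + 1) 0) gammaFive 1 *
          torusBilinear f g (Torus.proj (2 * S + 1) v) (Torus.proj (2 * S + 1) v) gammaFive 1 *
        fermiBoltzmann U mq)
    ∂(wilsonMeasure (fundamentalRep (Fin 3)) β))

local notation "zAP⟪" β ", " S ", " mq "⟫" =>
  (∫ U : GaugeConfig 4 (2 * S + 1) (Matrix.specialUnitaryGroup (Fin 3) ℂ),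
      fermiIntegral (fermiBoltzmannAP U mq) ∂(wilsonMeasure (fundamentalRep (Fin 3)) β))

local notation "zP⟪" β ", " S ", " mq "⟫" =>
  (∫ U : GaugeConfig 4 (2 * S + 1) (Matrix.specialUnitaryGroup (Fin 3) ℂ),
      fermiIntegral (fermiBoltzmann U mq) ∂(wilsonMeasure (fundamentalRep (Fin 3)) β))

local notation "dAP⟪" β ", " S ", " mq ", " f ", " g ", " T ", " h ", " n "⟫" =>
  (∑ z ∈ (T : Finset (Literature.Probability.LatticeModels.Site 4)),
    ∑ z' ∈ (T : Finset (Literature.Probability.LatticeModels.Site 4)),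
      (((h : Literature.Probability.LatticeModels.Site 4 → ℝ) z * h z' : ℝ) : ℂ) *
        nAP⟪β, S, mq, f, g, (Pi.single (0 : Fin 4) (((n : ℕ) : ℤ)) + (z' - z))⟫)

-- `APTI⟪Nf⟫`: translation invariance of the un-normalised antiperiodic two-bilinear functional.
set_option quotPrecheck false in
local notation "APTI⟪" Nf "⟫" =>
  (∀ (β : ℝ) (S : ℕ) (mq : Fin Nf → ℝ) (f g f' g' : Fin Nf) (Γ Γ' : Matrix (Fin 4) (Fin 4) ℂ)
      (x y u : TorusSite 4 (2 * S + 1)),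
    (∫ U : GaugeConfig 4 (2 * S + 1) (Matrix.specialUnitaryGroup (Fin 3) ℂ),
        fermiIntegral (torusBilinear f g x x Γ 1 * torusBilinear f' g' y y Γ' 1 * fermiBoltzmannAP U mq)
      ∂(wilsonMeasure (fundamentalRep (Fin 3)) β)) =
    ∫ U : GaugeConfig 4 (2 * S + 1) (Matrix.specialUnitaryGroup (Fin 3) ℂ),
        fermiIntegral (torusBilinear f g (x + u) (x + u) Γ 1 * torusBilinear f' g' (y + u) (y + u) Γ' 1 *
          fermiBoltzmannAP U mq)
      ∂(wilsonMeasure (fundamentalRep (Fin 3)) β))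

-- `TP⟪Nf⟫`: the RP–Hankel form of transfer positivity (even separations, phase `u`).
set_option quotPrecheck false in
local notation "TP⟪" Nf "⟫" =>
  (∀ (β : ℝ), 0 ≤ β → ∀ (S : ℕ), 1 ≤ S → ∀ (mq : Fin Nf → ℝ), (∀ fl, -1 < mq fl) → ∀ (f g : Fin Nf),
    ∃ u : ℂ, ‖u‖ = 1 ∧
      (∀ (T : Finset (Literature.Probability.LatticeModels.Site 4)) (h : Literature.Probability.LatticeModels.Site 4 → ℝ),
        (∀ z ∈ T, z 0 = 0 ∧ ∀ i, |z i| ≤ (S : ℤ)) →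
        ∀ (s t : ℕ), 1 ≤ s → s ≤ S → 1 ≤ t → t ≤ S →
          0 ≤ u * dAP⟪β, S, mq, f, g, T, h, 2 * s⟫ ∧
          ‖dAP⟪β, S, mq, f, g, T, h, s + t⟫‖ ^ 2 ≤
            (u * dAP⟪β, S, mq, f, g, T, h, 2 * s⟫).re * (u * dAP⟪β, S, mq, f, g, T, h, 2 * t⟫).re) ∧
      (∀ (t : ℕ) (w : Literature.Probability.LatticeModels.Site 4), 1 ≤ t → t ≤ S → w 0 = 0 →
        (∀ i, |w i| ≤ (S : ℤ)) →
          ‖nAP⟪β, S, mq, f, g, (Pi.single (0 : Fin 4) (((2 * t : ℕ) : ℤ)) + w)⟫‖ ≤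
            (u * nAP⟪β, S, mq, f, g, (Pi.single (0 : Fin 4) (((2 * t : ℕ) : ℤ)))⟫).re))

-- `CHORD`: local log-convexity of a non-negative finite sequence gives the three-point chord inequality.
set_option quotPrecheck false in
local notation "CHORD" =>
  (∀ (e : ℕ → ℝ) (N : ℕ), (∀ j, 1 ≤ j → j ≤ N → 0 ≤ e j) →
    (∀ j, 2 ≤ j → j + 1 ≤ N → e j ^ 2 ≤ e (j - 1) * e (j + 1)) →
    ∀ i j k : ℕ, 1 ≤ i → i < j → j < k → k ≤ N → e j ^ (k - i) ≤ e i ^ (k - j) * e k ^ (j - i))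

-- `LOGROOM⟪reg⟫`: superlogarithmic physical volume.
set_option quotPrecheck false in
local notation "LOGROOM⟪" reg "⟫" =>
  (Tendsto (fun k => QCDRegularisation.a reg k * (QCDRegularisation.L reg k : ℝ) /
    (1 + |Real.log (QCDRegularisation.a reg k)|)) atTop atTop)

-- `TWIST⟪Nf, reg⟫`: the `(−1)^F` twist is invisible at log-scale separations, at `S = L_k`, eventually.
set_option quotPrecheck false in
local notation "TWIST⟪" Nf ", " reg "⟫" =>
  (∀ (m : Fin Nf → ℝ), (∀ fl, 0 < m fl) → ∀ (f g : Fin Nf), f ≠ g → ∀ K : ℝ, ∀ᶠ k in atTop,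
    2 * ‖zAP⟪QCDRegularisation.β reg k, QCDRegularisation.L reg k,
            fun fl => QCDRegularisation.mcrit reg k + QCDRegularisation.a reg k * m fl / QCDRegularisation.Zm reg k⟫ -
          zP⟪QCDRegularisation.β reg k, QCDRegularisation.L reg k,
            fun fl => QCDRegularisation.mcrit reg k + QCDRegularisation.a reg k * m fl / QCDRegularisation.Zm reg k⟫‖ ≤
      ‖zAP⟪QCDRegularisation.β reg k, QCDRegularisation.L reg k,
          fun fl => QCDRegularisation.mcrit reg k + QCDRegularisation.a reg k * m fl / QCDRegularisation.Zm reg k⟫‖ ∧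
    ∀ n : ℕ, (n : ℝ) * QCDRegularisation.a reg k ≤ K * (1 + |Real.log (QCDRegularisation.a reg k)|) →
      2 * ‖nAP⟪QCDRegularisation.β reg k, QCDRegularisation.L reg k,
              fun fl => QCDRegularisation.mcrit reg k + QCDRegularisation.a reg k * m fl / QCDRegularisation.Zm reg k,
              f, g, (Pi.single (0 : Fin 4) ((n : ℕ) : ℤ))⟫ -
            nP⟪QCDRegularisation.β reg k, QCDRegularisation.L reg k,
              fun fl => QCDRegularisation.mcrit reg k + QCDRegularisation.a reg k * m fl / QCDRegularisation.Zm reg k,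
              f, g, (Pi.single (0 : Fin 4) ((n : ℕ) : ℤ))⟫‖ ≤
        ‖nAP⟪QCDRegularisation.β reg k, QCDRegularisation.L reg k,
            fun fl => QCDRegularisation.mcrit reg k + QCDRegularisation.a reg k * m fl / QCDRegularisation.Zm reg k,
            f, g, (Pi.single (0 : Fin 4) ((n : ℕ) : ℤ))⟫‖)

-- `LIGHT⟪Nf, reg⟫`: LatticeLightness at EVEN lattice times `2n₁ < 2n₂` within a fixed physical distance, with a
-- polynomial floor relative to `‖Z_AP‖ > 0`, frequently in `k`, at `S = L_k`.
set_option quotPrecheck false in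
local notation "LIGHT⟪" Nf ", " reg "⟫" =>
  (∀ ε : ℝ, 0 < ε → ∃ m : Fin Nf → ℝ, (∀ fl, 0 < m fl) ∧ ∃ (f g : Fin Nf), f ≠ g ∧
    ∃ (R : ℝ) (p : ℕ) (C : ℝ), 0 < C ∧ ∃ᶠ k in atTop,
      ∃ (T : Finset (Literature.Probability.LatticeModels.Site 4)) (h : Literature.Probability.LatticeModels.Site 4 → ℝ)
        (n₁ n₂ : ℕ),
        1 ≤ n₁ ∧ n₁ < n₂ ∧ (n₂ : ℝ) * QCDRegularisation.a reg k ≤ R ∧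
        (∀ z ∈ T, z 0 = 0 ∧ ∀ i, |z i| ≤ (n₂ : ℤ)) ∧
        0 < ∑ z ∈ T, |h z| ∧
        0 < ‖zAP⟪QCDRegularisation.β reg k, QCDRegularisation.L reg k,
              fun fl => QCDRegularisation.mcrit reg k + QCDRegularisation.a reg k * m fl / QCDRegularisation.Zm reg k⟫‖ ∧
        C * QCDRegularisation.a reg k ^ p * ((∑ z ∈ T, |h z|) ^ 2 *
            ‖zAP⟪QCDRegularisation.β reg k, QCDRegularisation.L reg k,
              fun fl => QCDRegularisation.mcrit reg k + QCDRegularisation.a reg k * m fl / QCDRegularisation.Zm reg k⟫‖) ≤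
          ‖dAP⟪QCDRegularisation.β reg k, QCDRegularisation.L reg k,
              fun fl => QCDRegularisation.mcrit reg k + QCDRegularisation.a reg k * m fl / QCDRegularisation.Zm reg k,
              f, g, T, h, 2 * n₂⟫‖ ∧
        ‖dAP⟪QCDRegularisation.β reg k, QCDRegularisation.L reg k,
            fun fl => QCDRegularisation.mcrit reg k + QCDRegularisation.a reg k * m fl / QCDRegularisation.Zm reg k,
            f, g, T, h, 2 * n₁⟫‖ ≤
          ‖dAP⟪QCDRegularisation.β reg k, QCDRegularisation.L reg k,
              fun fl => QCDRegularisation.mcrit reg k + QCDRegularisation.a reg k * m fl / QCDRegularisation.Zm reg k,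
              f, g, T, h, 2 * n₂⟫‖ * Real.exp (ε * (QCDRegularisation.a reg k * ((n₂ : ℝ) - n₁))))

/-! ### (end of NOTATION PRELUDE — statements below must use these notations verbatim) -/

open Summit.QuantumFields.QCD.Cruxes.PhaseQuenchedFlavourDecay.CrossingSplitIntegrability

/-- **Stub 4 · the lift** (registered stub `stub_pinOfLatticeLightness` of line `log-convex-continuum-lift`):
transfer positivity in RP–Hankel form and the chord inequality turn, for every mass-independent
regularisation with `β_k ≥ 0` eventually and admissible bare masses, superlogarithmic volume + twist
insensitivity + lattice lightness (even times, floor relative to `‖Z_AP‖ > 0`, frequently in `k`) into the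
chiral pin `reg.IsChiralAtZero`: the light masses `m` of `LIGHT ε` carry no uniform lattice gap `ε`, since
the gap bound on the flavour-charged pion pair at `S = L_k` and the log-scale separation
`2⌈K|log a_k|/(2a_k)⌉`, `K = 2(p+1)/ε`, contradicts the log-convex lower bound propagated from the light
window (module docstring; arithmetic core `Lift.stub_pinOfLatticeLightness_core`). [folklore; Montvay–Münster 1994 §5.1,
Osterwalder–Seiler 1978 §2] -/
theorem stub_pinOfLatticeLightness : ∀ Nf : ℕ, TP⟪Nf⟫ → CHORD →
    ∀ reg : QCDRegularisation Nf, (∀ᶠ k in atTop, 0 ≤ reg.β k) →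
      (∀ m : Fin Nf → ℝ, (∀ f, 0 < m f) → ∀ f : Fin Nf, ∀ᶠ k in atTop, -1 < reg.mcrit k + reg.a k * m f / reg.Zm k) →
      LOGROOM⟪reg⟫ → TWIST⟪Nf, reg⟫ → LIGHT⟪Nf, reg⟫ → reg.IsChiralAtZero := by
  intro Nf hTP hchord reg hβ hmass hroom htwist hlight ε hε
  obtain ⟨m, hm, f, g, hfg, R, p, C, hC, hfreq⟩ := hlight ε hε
  refine ⟨m, hm, fun hgap => ?_⟩
  obtain ⟨C', hC'⟩ := hgap 1 1 (pseudoscalarDensityObs Nf (Matrix.single g f (1 : ℂ)))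
    (pseudoscalarDensityObs Nf (Matrix.single f g (1 : ℂ)))
  -- the constant `K := 2(p+1)/ε`
  obtain ⟨K, hK0, hKε⟩ : ∃ K : ℝ, 0 < K ∧ ε * K = 2 * (p + 1) :=
    ⟨2 * (p + 1) / ε, by positivity, by field_simp⟩
  -- the eventual conditions on the cutoff index `k`
  have hev_mass : ∀ᶠ k in atTop, ∀ fl, -1 < reg.mcrit k + reg.a k * m fl / reg.Zm k :=
    eventually_all.2 fun fl => hmass m hm fl
  have hev_tw := htwist m hm f g hfg (K + 2)
  have hev_a1 : ∀ᶠ k in atTop, reg.a k ≤ 1 / 2 := reg.tendsto_a.eventually_le_const (by norm_num)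
  have hev_a2 : ∀ᶠ k in atTop, C' * reg.a k < C / 3 :=
    (reg.tendsto_a.const_mul C').eventually_lt_const (by rw [mul_zero]; positivity)
  have hev_a3 : ∀ᶠ k in atTop, reg.a k < Real.exp (-(2 * R / K)) :=
    reg.tendsto_a.eventually_lt_const (Real.exp_pos _)
  have hev_L : ∀ᶠ k in atTop,
      max (2 * R) (K + 2) ≤ reg.a k * (reg.L k : ℝ) / (1 + |Real.log (reg.a k)|) :=
    hroom.eventually_ge_atTop _
  -- ONE index `k` in the frequent set of `LIGHT` and in all the eventual sets
  obtain ⟨k, hLk, ⟨⟨⟨⟨⟨⟨hCk, hβk⟩, hmk⟩, htwk⟩, ha1⟩, ha2⟩, ha3⟩, hL⟩ :=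
    (hfreq.and_eventually
      (((((((hC'.and hβ).and hev_mass).and hev_tw).and hev_a1).and hev_a2).and hev_a3).and hev_L)).exists
  obtain ⟨T, h, n₁, n₂, hn₁, hn₁₂, hn₂R, hT, hH, hZA, hfloor, hlt⟩ := hLk
  obtain ⟨htwZ, htwN⟩ := htwk
  -- `1 ≤ L_k` (the volume condition is violated by `L_k = 0`)
  have hL1 : 1 ≤ reg.L k := by
    rcases Nat.eq_zero_or_pos (reg.L k) with h0 | h0
    · exfalso
      rw [h0, Nat.cast_zero, mul_zero, zero_div] at hL
      linarith [le_max_right (2 * R) (K + 2)]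
    · exact h0
  -- transfer positivity at `(β_k, L_k, bare masses, f, g)`
  obtain ⟨u, hu, hG12, hG3⟩ := hTP (reg.β k) hβk (reg.L k) hL1
    (fun fl => reg.mcrit k + reg.a k * m fl / reg.Zm k) hmk f g
  -- the gap bound at `S = L_k` on the charged pion pair, rewritten as `N_P(n e₀) / Z_P`
  have hgapk : ∀ n : ℕ, n ≤ reg.L k →
      ‖nP⟪reg.β k, reg.L k, fun fl => reg.mcrit k + reg.a k * m fl / reg.Zm k, f, g,
            (Pi.single (0 : Fin 4) ((n : ℕ) : ℤ))⟫ /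
          zP⟪reg.β k, reg.L k, fun fl => reg.mcrit k + reg.a k * m fl / reg.Zm k⟫‖ ≤
        C' * Real.exp (-(ε * (reg.a k * n))) := by
    intro n hn
    have h1 : ‖qcdLatticeConnectedCorr (reg.β k) (2 * reg.L k + 1)
        (fun fl => reg.mcrit k + reg.a k * m fl / reg.Zm k)
        (pseudoscalarDensityObs Nf (Matrix.single g f (1 : ℂ)))
        (pseudoscalarDensityObs Nf (Matrix.single f g (1 : ℂ))) n‖ ≤
        C' * Real.exp (-(ε * (reg.a k * n))) := hCk (reg.L k) le_rfl n hn
    rw [(isFlavourCharged_pseudoscalarDensityObs_single hfg).qcdLatticeConnectedCorr_eq one_ne_zero] at h1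
    simpa only [qcdTorusExpect, pseudoscalarDensityObs_single_onTorus] using h1
  -- everything else is the abstract arithmetic of `stub_pinOfLatticeLightness_core`; all data are passed explicitly and the
  -- large hypotheses are matched one at a time (a one-shot `exact` makes unification expensive)
  refine stub_pinOfLatticeLightness_core (ε := ε) (a := reg.a k) (K := K) (R := R) (C := C) (C' := C') (p := p)
    (S := reg.L k) (n₁ := n₁) (n₂ := n₂) (T := T) (h := h) (u := u)
    (N := fun v : Literature.Probability.LatticeModels.Site 4 =>
      nAP⟪reg.β k, reg.L k, fun fl => reg.mcrit k + reg.a k * m fl / reg.Zm k, f, g, v⟫)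
    (D := fun T' h' n =>
      dAP⟪reg.β k, reg.L k, fun fl => reg.mcrit k + reg.a k * m fl / reg.Zm k, f, g, T', h', n⟫)
    (NP := fun n : ℕ =>
      nP⟪reg.β k, reg.L k, fun fl => reg.mcrit k + reg.a k * m fl / reg.Zm k, f, g,
        (Pi.single (0 : Fin 4) ((n : ℕ) : ℤ))⟫)
    (ZA := zAP⟪reg.β k, reg.L k, fun fl => reg.mcrit k + reg.a k * m fl / reg.Zm k⟫)
    (ZP := zP⟪reg.β k, reg.L k, fun fl => reg.mcrit k + reg.a k * m fl / reg.Zm k⟫)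
    hchord ?_ hε (reg.a_pos k) hC hK0 hKε hn₁ hn₁₂ hn₂R hT hH hZA ?_ ?_ hu ?_ ?_ htwZ ?_ ?_ ha1 ha2 ha3 hL
  · exact fun _ _ _ => rfl  -- `D` is the smearing of `N`
  · exact hfloor            -- the polynomial floor at `2n₂`
  · exact hlt               -- lattice lightness between `2n₁` and `2n₂`
  · exact hG12              -- (G1), (G2) of transfer positivity
  · exact hG3               -- (G3) of transfer positivity
  · exact htwN              -- twist insensitivity of the numerator
  · exact hgapk             -- the gap bound as `N_P / Z_P`

end Summit.QuantumFields.QCD.Cruxes.ChiralOneScaleTrajectory.LogConvexLift.Lift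

end
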